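import Literature.AnabelianGeometry.AbsoluteAnabelian.DVRDivisibleUnitsTorsion
import Literature.FieldTheory.Kummer.ConstantsValuation
import Literature.FieldTheory.Regular.FiniteAlgebraicClosure
import HarnessLib

/-!
# Infinitely divisible units of finitely generated extensions of `Frac A` (`A` a DVR) are torsion

Let `A` be a discrete valuation ring with `p ∈ 𝔪_A` and residue field algebraic over `𝔽_p`
(hypothesis `hres`), `F = Frac A` of characteristic `0`, and `L/F` a finitely generated field
extension.  Then every `x ∈ L^×` that is an `N`-th power for all `N ≥ 1` has finite order
(`isOfFinOrder_of_forall_exists_pow_eq_of_essFiniteType`).  With `A = W(𝔽̄_p)` this says: the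
infinitely divisible elements of a finitely generated extension of `Frac W(𝔽̄_p)` — the fields in
the definition of "generalized sub-`p`-adic" ([Tpcs] Def 4.11) — are roots of unity; it is the
field-theoretic input of the class-field-theory-free proof of [Tpcs] Lemma 4.14 (S. Mochizuki,
*Topics surrounding the anabelian geometry of hyperbolic curves* (2003), p. 48; cell decl
`Tpcs.Lem_4_14`).

Proof: (1) `x` is algebraic over `F` — otherwise a discrete valuation of `L/F` with `v(x) < 1`
(tree: `ConstantsValuation.exists_valuation_lt_one_of_transcendental`) contradicts divisibility;
likewise every root of `x`.  (2) The relative algebraic closure `F' = F(s)` of `F` in `L` is a finite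
extension (tree: `Regular.exists_finset_isAlgClosedIn`) containing `x` and all its roots, so `x` is
infinitely divisible in `F'`.  (3) Apply the finite case
(`isOfFinOrder_of_forall_exists_pow_eq_of_finiteDimensional`).  Proof-only, no definitions.
[cite: MochizukiTopics2003, Lem 4.14 p.48]
-/

noncomputable section

open scoped Classical
open Polynomial IsLocalRing

namespace Literature.AnabelianGeometry.AbsoluteAnabelian

universe u v

/-- **Infinitely divisible units of a finitely generated extension `L` of `Frac A` (`A` a DVR with
`p ∈ 𝔪_A` and residue field algebraic over `𝔽_p`, `char F = 0`) have finite order.**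
[cite: MochizukiTopics2003, Lem 4.14 p.48] -/
theorem isOfFinOrder_of_forall_exists_pow_eq_of_essFiniteType
    (A : Type v) [CommRing A] [IsDomain A] [IsDiscreteValuationRing A]
    (F : Type u) [Field F] [CharZero F] [Algebra A F] [IsFractionRing A F]
    {p : ℕ} [Fact p.Prime] (hp : (p : A) ∈ maximalIdeal A)
    (hres : ∀ a : A, ∃ f : ℤ[X], f.Monic ∧ aeval a f ∈ maximalIdeal A)
    (L : Type u) [Field L] [Algebra F L] [Algebra.EssFiniteType F L]
    (x : Lˣ) (hx : ∀ N : ℕ, 0 < N → ∃ y : Lˣ, y ^ N = x) : IsOfFinOrder x := by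
  have hfg : ∃ s : Finset L, IntermediateField.adjoin F (s : Set L) = ⊤ :=
    IntermediateField.fg_top F L
  -- (1) infinitely divisible elements are algebraic over `F`
  have halg : ∀ z : Lˣ, (∀ N : ℕ, 0 < N → ∃ y : Lˣ, y ^ N = z) → IsAlgebraic F (z : L) := by
    intro z hz
    by_contra htr
    obtain ⟨v, -, hvz, hvz0⟩ :=
      Literature.FieldTheory.Kummer.ConstantsValuation.exists_valuation_lt_one_of_transcendental
        hfg (z := (z : L)) htr
    have hv1 : v (z : L) = 1 := by
      refine withZero_eq_one_of_forall_pow hvz0 fun N hN => ?_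
      obtain ⟨y, hy⟩ := hz N hN
      exact ⟨v (y : L), by rw [← map_pow, ← Units.val_pow_eq_pow_val, hy]⟩
    exact (lt_irrefl _) (hv1 ▸ hvz)
  have hxalg : IsAlgebraic F (x : L) := halg x hx
  have hyalg : ∀ (N : ℕ) (y : Lˣ), 0 < N → y ^ N = x → IsAlgebraic F (y : L) := by
    intro N y hN hy
    refine IsAlgebraic.of_pow hN ?_
    rw [← Units.val_pow_eq_pow_val, hy]
    exact hxalg
  -- (2) the relative algebraic closure `F' = F(s)`, a finite extension of `F`
  obtain ⟨s, hsalg, hclosed⟩ := Literature.FieldTheory.Regular.exists_finset_isAlgClosedIn (k := F) (E := L)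
  set F' : IntermediateField F L := IntermediateField.adjoin F (s : Set L) with hF'
  haveI : FiniteDimensional F F' :=
    IntermediateField.finiteDimensional_adjoin fun z hz => (hsalg z hz).isIntegral
  have hmem : ∀ z : L, IsAlgebraic F z → z ∈ F' := fun z hz => hclosed z (hz.tower_top F')
  have hxF' : (x : L) ∈ F' := hmem _ hxalg
  -- `x` as a unit of `F'`, infinitely divisible there
  have hx0' : (⟨x, hxF'⟩ : F') ≠ 0 := fun h => x.ne_zero (congrArg Subtype.val h)
  set xF : (F' : Type u)ˣ := Units.mk0 _ hx0' with hxF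
  have hxFdiv : ∀ N : ℕ, 0 < N → ∃ y : (F' : Type u)ˣ, y ^ N = xF := by
    intro N hN
    obtain ⟨y, hy⟩ := hx N hN
    have hyF' : (y : L) ∈ F' := hmem _ (hyalg N y hN hy)
    have hy0' : (⟨y, hyF'⟩ : F') ≠ 0 := fun h => y.ne_zero (congrArg Subtype.val h)
    refine ⟨Units.mk0 _ hy0', Units.ext (Subtype.ext ?_)⟩
    simp only [Units.val_pow_eq_pow_val, Units.val_mk0, hxF]
    push_cast
    rw [← Units.val_pow_eq_pow_val, hy]
  -- (3) the finite case
  letI : Algebra A F' := ((algebraMap F F').comp (algebraMap A F)).toAlgebra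
  haveI : IsScalarTower A F F' := IsScalarTower.of_algebraMap_eq fun _ => rfl
  have hfin : IsOfFinOrder xF :=
    isOfFinOrder_of_forall_exists_pow_eq_of_finiteDimensional A F hp hres xF hxFdiv
  obtain ⟨m, hm, hxm⟩ := hfin.exists_pow_eq_one
  refine isOfFinOrder_iff_pow_eq_one.mpr ⟨m, hm, Units.ext ?_⟩
  have := congrArg (fun w : (F' : Type u)ˣ => ((w : F') : L)) hxm
  simpa [hxF, Units.val_pow_eq_pow_val] using this

end Literature.AnabelianGeometry.AbsoluteAnabelian
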